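import Summits.AtomisticToContinuum.Crystallization.Theorems.ChartedZeroExcessLayeredLatticeLiouvilleZZDA

/-!
# Part ZZD «ConeLemma» — part 2 of 2 (sequel of `…LiouvilleZZDA`, whose module docstring describes the rider; lens-2 g80)

Split for the 400-line cap by the landing lane (hand-2 g38) at §2 ‖ §3 (the lint refuses the 489-l single module GO'd by critic row 1443 (B)).  This part: §3 an atom toward
any direction, §4 the zone-neighbour lemma, §5 the record corollaries, §6 shadow.  Same namespace and opens; all FQNs unchanged; bodies verbatim.  0 sorry; standard axioms.
-/

noncomputable section
open scoped BigOperators Classical InnerProductSpace RealInnerProductSpace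
open MeasureTheory Set Metric Filter Topology
open Summit.AtomisticToContinuum.Crystallization.Theorems.ChartedPlanarOrderRigidityDoor (E3 IsClean IsCharted)
open Summit.AtomisticToContinuum.Crystallization.Theorems.ChartedPlanarOrderDensityDichotomy (μS IsSep)
open Summit.AtomisticToContinuum.Crystallization.Theorems.ChartedPlanarOrderCleanScaleP (IsCleanP IsDoorSetP isCleanP_one_iff isCleanP_μS_iff)
open Summit.AtomisticToContinuum.Crystallization.Theorems.ChartedPlanarOrderMesoCut (LayeredHom EnvClose)
open Summit.AtomisticToContinuum.Crystallization.Theorems.ChartedPlanarOrderDoorLayeredOsc (IsTwoShellAffineGood mem_iff_μS_singleton_ne_zero)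
open Literature.MathematicalPhysics.StatisticalMechanics (lennardJones triangularVec₁ triangularVec₂)
open Literature.Geometry.DiscreteGeometry (IsTwoShellGoodSet intVec intVec_apply fccInt hcpInt fccKissingPattern hcpKissingPattern scaledPattern
  fccTwoShellPattern hcpTwoShellPattern fccKissingPattern_subset hcpKissingPattern_subset norm_eq_one_of_mem_fccKissingPattern
  norm_eq_one_of_mem_hcpKissingPattern)


namespace Summit.AtomisticToContinuum.Crystallization.Theorems.ChartedZeroExcessLayeredLatticeLiouville

/-! ### §3  An atom toward any direction, from two-shell cleanliness -/

/-- `√2 < 1.42`. [formal bookkeeping] -/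
theorem sqrt_two_lt_142 : Real.sqrt 2 < 142 / 100 := by
  rw [Real.sqrt_lt' (by norm_num)]; norm_num

/-- ★ **AN ATOM TOWARD ANY DIRECTION**: at a `(1/16, 9/10, aHi)`-two-shell-good site `p` of `S`, for every direction `w ≠ 0` there is an atom
`n ∈ S` with `15/16·(9/10) ≤ dist n p ≤ 17/16·aHi` (so `0 < dist`) and `∠(n − p, w) ≤ 60°`: `½‖n − p‖‖w‖ ≤ ⟪n − p, w⟫` — the first-shell
atom matched to the kissing vector within `45°` of `A⁻¹ w` (`exists_kissing_toward`), displaced by `≤ a/16`; `√2/2 − 1/16 ≥ 17/32`.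
[this file, g80] -/
theorem exists_atom_toward {aHi : ℝ} {S : Set E3} {p : E3} (hgood : IsTwoShellGoodSet (1 / 16) (9 / 10) aHi S p) {w : E3} (hw : w ≠ 0) :
    ∃ n ∈ S, 0 < dist n p ∧ dist n p ≤ 17 / 16 * aHi ∧ (1 / 2) * (‖n - p‖ * ‖w‖) ≤ ⟪n - p, w⟫_ℝ := by
  obtain ⟨a, ha9, haHi, A, P, f, hP, hf, -, -⟩ := hgood
  have ha0 : 0 < a := by linarith
  have hs2 : 0 < Real.sqrt 2 := Real.sqrt_pos.2 (by norm_num)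
  -- pull `w` back through the linear isometry `A` (onto, in finite dimension)
  obtain ⟨w₀, hw₀'⟩ := (A.toLinearIsometryEquiv rfl).surjective w
  have hw₀ : A w₀ = w := by rw [← hw₀', LinearIsometry.toLinearIsometryEquiv_apply]
  have hnw : ‖w‖ = ‖w₀‖ := by rw [← hw₀, A.norm_map]
  obtain ⟨v, hvP, hv1, hvw⟩ := exists_kissing_toward hP w₀
  obtain ⟨hnS, hne⟩ := hf v hvP
  have hAvw : ⟪A v, w⟫_ℝ = ⟪v, w₀⟫_ℝ := by rw [← hw₀, A.inner_map_map]
  -- `f v − p = a • A v + e`, `‖e‖ ≤ a/16`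
  obtain ⟨e, he⟩ : ∃ e : E3, e = f v - (p + a • A v) := ⟨_, rfl⟩
  have henorm : ‖e‖ ≤ 1 / 16 * a := by rw [he, ← dist_eq_norm]; exact hne
  have hdecomp : f v - p = a • A v + e := by rw [he]; abel
  have hAv : ‖a • A v‖ = a := by rw [norm_smul, Real.norm_of_nonneg ha0.le, A.norm_map, hv1, mul_one]
  have hup : ‖f v - p‖ ≤ 17 / 16 * a := by
    rw [hdecomp]
    calc ‖a • A v + e‖ ≤ ‖a • A v‖ + ‖e‖ := norm_add_le _ _
      _ ≤ a + 1 / 16 * a := add_le_add hAv.le henorm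
      _ = 17 / 16 * a := by ring
  have hlo : 15 / 16 * a ≤ ‖f v - p‖ := by
    rw [hdecomp]
    have h := norm_sub_le (a • A v + e) e
    rw [add_sub_cancel_right, hAv] at h
    linarith
  -- the inner product
  have hI0 : 0 ≤ ⟪v, w₀⟫_ℝ := by
    by_contra h
    have h' : Real.sqrt 2 * ⟪v, w₀⟫_ℝ < 0 := mul_neg_of_pos_of_neg hs2 (lt_of_not_ge h)
    linarith [norm_nonneg w₀]
  have hI : ‖w‖ ≤ 142 / 100 * ⟪v, w₀⟫_ℝ := by
    rw [hnw]; exact hvw.trans (mul_le_mul_of_nonneg_right sqrt_two_lt_142.le hI0)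
  have hew : -(1 / 16 * a * ‖w‖) ≤ ⟪e, w⟫_ℝ := by
    have h1 := neg_le_of_abs_le (abs_real_inner_le_norm e w)
    have h2 : ‖e‖ * ‖w‖ ≤ 1 / 16 * a * ‖w‖ := mul_le_mul_of_nonneg_right henorm (norm_nonneg _)
    linarith
  refine ⟨f v, hnS, ?_, ?_, ?_⟩
  · rw [dist_eq_norm]; linarith
  · rw [dist_eq_norm]; exact hup.trans (by linarith)
  · calc (1 / 2) * (‖f v - p‖ * ‖w‖) ≤ (1 / 2) * (17 / 16 * a * ‖w‖) := by gcongr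
      _ ≤ a * ⟪v, w₀⟫_ℝ - 1 / 16 * a * ‖w‖ := by
          nlinarith [mul_nonneg ha0.le (sub_nonneg.2 hI), mul_nonneg ha0.le (norm_nonneg w)]
      _ ≤ a * ⟪v, w₀⟫_ℝ + ⟪e, w⟫_ℝ := by linarith
      _ = ⟪f v - p, w⟫_ℝ := by rw [hdecomp, inner_add_left, real_inner_smul_left, hAvw]

/-! ### §4  ★ The zone-neighbour lemma: a bond step away from the container -/

/-- ★★ **A ZONE ATOM HAS A BOND NEIGHBOUR IN THE ZONE, ONE STEP OUT (symbolic dials).**  Container `K ⊆ B̄(x₀, q)` with `2q ≤ r`, `0 < r`;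
a `(1/16, 9/10, aHi)`-clean moat atom `p ∈ moatIn S K r ℓ` with `dist p x₀ ≤ ρ`, `ρ + 17/16·aHi + q < ℓ` and `17/16·aHi ≤ 28/25`: there is a
BOND neighbour `n ∈ moatIn S K r ℓ` (`0 < dist p n ≤ 28/25`) with `dist n x₀ ≤ ρ + 17/16·aHi`.  Proof: the atom toward `w = p − x₀` (§3) makes an
angle `≥ 120°` with `x₀ − p`, hence (cone lemma §1) stays at distance `> r` from every `y ∈ K`; the outer constraints are the triangle inequality.
At the cavity dials (`q > r`) the hypothesis `2q ≤ r` fails and ZZC's isolated sites exist. [this file, g80] -/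
theorem exists_zone_neighbour_of_container {q r ℓ ρ aHi : ℝ} (hqr : 2 * q ≤ r) (hr : 0 < r) {S K : Set E3} {x₀ p : E3}
    (hK : ∀ k ∈ K, dist k x₀ ≤ q) (hgood : IsTwoShellGoodSet (1 / 16) (9 / 10) aHi S p) (hp : p ∈ moatIn S K r ℓ)
    (hpx : dist p x₀ ≤ ρ) (hℓ : ρ + 17 / 16 * aHi + q < ℓ) (hb : 17 / 16 * aHi ≤ 28 / 25) :
    ∃ n ∈ moatIn S K r ℓ, IsBond p n ∧ dist n x₀ ≤ ρ + 17 / 16 * aHi := by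
  obtain ⟨hpS, ⟨y₀, hy₀K, hy₀⟩, hfar⟩ := hp
  -- the direction away from `x₀` is nonzero (`dist p x₀ ≥ r − q > 0`)
  have hw : p - x₀ ≠ 0 := by
    intro h
    have hp0 : p = x₀ := sub_eq_zero.1 h
    have h1 := hfar y₀ hy₀K
    have h2 := hK y₀ hy₀K
    rw [hp0, dist_comm] at h1
    have hq : q < r := by
      have hq0 : 0 ≤ q := dist_nonneg.trans h2
      linarith
    linarith
  obtain ⟨n, hnS, hpos, hle, hinner⟩ := exists_atom_toward hgood hw
  have hcone : ⟪n - p, x₀ - p⟫_ℝ ≤ -(1 / 2) * (‖n - p‖ * ‖x₀ - p‖) := by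
    rw [show x₀ - p = -(p - x₀) by abel, inner_neg_right, norm_neg]; linarith
  have hnx : dist n x₀ ≤ ρ + 17 / 16 * aHi :=
    calc dist n x₀ ≤ dist n p + dist p x₀ := dist_triangle _ _ _
      _ ≤ 17 / 16 * aHi + ρ := add_le_add hle hpx
      _ = ρ + 17 / 16 * aHi := add_comm _ _
  refine ⟨n, ⟨hnS, ⟨y₀, hy₀K, ?_⟩, fun y hyK => ?_⟩, ⟨by rw [dist_comm]; exact hpos, by rw [dist_comm]; exact hle.trans hb⟩, hnx⟩
  · calc dist n y₀ ≤ dist n x₀ + dist x₀ y₀ := dist_triangle _ _ _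
      _ ≤ (ρ + 17 / 16 * aHi) + q := add_le_add hnx (by rw [dist_comm]; exact hK y₀ hy₀K)
      _ < ℓ := hℓ
  · exact lt_dist_of_cone hqr hr.le (hK y hyK) (by rw [dist_comm]; exact hfar y hyK) hcone

/-! ### §5  The record corollaries: no isolated zone `P`-site at the record dials -/

/-- ★ **RECORD COROLLARY** (container radius `4`, zone inner radius `8`, `P`-radius `57/4`, landing radius `57/4 + 17/16·aHi ≤ 82/5`, moat width
`43/2`, `aHi ≤ 1`): every clean zone `P`-atom has a bond neighbour in the zone's `R`-region. [this file, g80] -/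
theorem exists_zone_neighbour_record {aHi : ℝ} (haHi : aHi ≤ 1) {S K : Set E3} {x₀ p : E3} (hK : ∀ k ∈ K, dist k x₀ ≤ 4)
    (hgood : IsTwoShellGoodSet (1 / 16) (9 / 10) aHi S p) (hp : p ∈ moatIn S K 8 (43 / 2)) (hpx : dist p x₀ ≤ 57 / 4) :
    ∃ n ∈ moatIn S K 8 (43 / 2), IsBond p n ∧ dist n x₀ ≤ 82 / 5 := by
  obtain ⟨n, hn, hb, hnx⟩ := exists_zone_neighbour_of_container (q := 4) (r := 8) (ρ := 57 / 4) (aHi := aHi) (ℓ := 43 / 2)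
    (by norm_num) (by norm_num) hK hgood hp hpx (by linarith) (by linarith)
  exact ⟨n, hn, hb, hnx.trans (by linarith)⟩

/-- ★★ **NO ISOLATED ZONE `P`-SITE AT THE RECORD (the closure of the g79 alert).**  For a `P`-door set `S` (`IsDoorSetP aHi δ S`, `aHi ≤ 1`), a
container `K ⊆ B̄(x₀, 4)` (the record binder `∀ k ∈ K, dist k x₀ ≤ 4` of (L2-S)/(L2-C)/(GL)) and a GLOBAL Barlow bond chart `Ψ` of `S` onto `S`
(part ZH), EVERY coordinate site `x ∈ zoneCoords Ψ S K 8 (43/2) (57/4) x₀` (the `P`-set of (L2-S) `DoorChartPinningP … 14 (57/4) (82/5)`) has a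
Barlow neighbour INSIDE `zoneCoords Ψ S K 8 (43/2) (82/5) x₀` (its `R`-set): the hypothesis `hiso` of ZZC's `not_isPinningDatum_of_isolated` has no
instance at the record dials. [this file, g80] -/
theorem exists_barlowAdj_zoneCoords_record {aHi δ : ℝ} (haHi : aHi ≤ 1) {S : Set E3} (hSd : IsDoorSetP aHi δ S) {K : Set E3} {x₀ : E3}
    (hK : ∀ k ∈ K, dist k x₀ ≤ 4) {Ψ : ℤ × ℤ × ℤ → E3} {τ : ℤ → Bool} (hΨ : IsBarlowBondChart S Set.univ Ψ τ)
    (hsurj : ∀ p ∈ S, ∃ x, Ψ x = p) {x : ℤ × ℤ × ℤ} (hx : x ∈ zoneCoords Ψ S K 8 (43 / 2) (57 / 4) x₀) :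
    ∃ y, BarlowAdj τ x y ∧ y ∈ zoneCoords Ψ S K 8 (43 / 2) (82 / 5) x₀ := by
  obtain ⟨hxm, hxρ⟩ := hx
  have hgood : IsTwoShellGoodSet (1 / 16) (9 / 10) aHi S (Ψ x) := (isCleanP_μS_iff S).1 hSd.2.2.1 (Ψ x) hxm.1
  obtain ⟨n, hn, hb, hnx⟩ := exists_zone_neighbour_record haHi hK hgood hxm hxρ
  obtain ⟨y, rfl⟩ := hsurj n hn.1
  exact ⟨y, (hΨ.2.2 x (Set.mem_univ _) y (Set.mem_univ _)).1 hb, hn, hnx⟩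

/-- ★ the same, as the NEGATION of ZZC's isolation hypothesis `hiso` at the record `P`/`R` sets. [this file, g80] -/
theorem not_isolated_zoneCoords_record {aHi δ : ℝ} (haHi : aHi ≤ 1) {S : Set E3} (hSd : IsDoorSetP aHi δ S) {K : Set E3} {x₀ : E3}
    (hK : ∀ k ∈ K, dist k x₀ ≤ 4) {Ψ : ℤ × ℤ × ℤ → E3} {τ : ℤ → Bool} (hΨ : IsBarlowBondChart S Set.univ Ψ τ)
    (hsurj : ∀ p ∈ S, ∃ x, Ψ x = p) {x : ℤ × ℤ × ℤ} (hx : x ∈ zoneCoords Ψ S K 8 (43 / 2) (57 / 4) x₀) :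
    ¬ (∀ y, BarlowAdj τ x y → y ∉ zoneCoords Ψ S K 8 (43 / 2) (82 / 5) x₀) := by
  intro hiso
  obtain ⟨y, hadj, hy⟩ := exists_barlowAdj_zoneCoords_record haHi hSd hK hΨ hsurj hx
  exact hiso y hadj hy

/-! ### §6  Shadow: the cavity dials are outside the cone regime -/

/-- the dials of ZZC's cavity instance (container radius `12`, inner radius `4`) violate the cone hypothesis `2q ≤ r`; the record dials
`(q, r) = (4, 8)` satisfy it with equality. [this file, g80] -/
theorem cavity_dials_outside_cone_regime : ¬ (2 * (12 : ℝ) ≤ 4) ∧ 2 * (4 : ℝ) ≤ 8 := by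
  constructor <;> norm_num

end Summit.AtomisticToContinuum.Crystallization.Theorems.ChartedZeroExcessLayeredLatticeLiouville

end
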